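import Summits.CriticalPhenomena.PercolationContinuityZ3.Theorems.Transplant.SkelPhiNegReachHoldsA
import Summits.CriticalPhenomena.PercolationContinuityZ3.Theorems.Transplant.SkelNegBParamsResidualsAF
import HarnessLib

/-!
# N1 (C) column at the slot-ledger (ζ′) **v2** tuple: `reachHoldsRHNOFnL_negChoiceAllOTA_exAF`

The (C) hypothesis `ReachHoldsRHNOFnL NegB.LfA (negChoiceAllOTA …)` of the length-budgeted additive closure
`samePDropOfSkeletonNeg₁_of_choiceFnNOWL` at the RE-VERSIONED slot value `Sv := SUA (exAF c) mx` (stmt-g16 `SkelNegBParamsResidualsAF`,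
slot ledger (ζ′) v2, lead g8 2026-08-22T08:07:29Z: `exAF c := exA + (r₀A 0 (RBF c 0) + 1)` absorbs the y′-face bridge pair's prism radius,
which the layer-(b) face glue needs (`hex.2`) and which no monotonicity bounds by the long pair's radius).  The general (C) wrapper
`reachHoldsRHNOFnL_negChoiceAllOTA (mk gx fx Px ex mx) (hex)` (SkelPhiNegReachHoldsA §2) reads EXACTLY the two `ex`-floors of `hex_exA`
(`r₀A mk (R (scale ML nL)) + 3 ≤ ex` and `4 + 13·(20K·(n_L + Q_w)) ≤ ex`), both monotone in `ex`, so they transport from `exA` to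
`exAF c ≥ exA` by `le_trans`.  Nothing else changes in the (C) column (the twelve (ζ′) files of record stand).

builds on p205010 (kernel theorem, internal audit signed; external expert review pending).
Status sentence (coordinator 2026-08-20T04:30Z): "θ(p_c) = 0 on ℤ^d, all d ≥ 2 — kernel-verified (Lean 4/Mathlib, standard axioms); internal
adversarial audit SIGNED 2026-08-20 04:29Z; external expert review pending."
Lane `prim-bschramm-*`, seat `prim-bschramm-p5` (gen 12; the (C) column is authored by the p5 lineage — DISCLOSED; counter-signature by a seat
outside the lineage per V112 (6)); helper file (`--supports stmt-CriticalPhenomena-4575 --as helper`).  Nothing about the node is claimed here.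
* `reachHoldsRHNOFnL_negChoiceAllOTA_exAF (c) (gx fx) (Px) (mx)` — general face-kit index `c`, widths `gx fx`, pairs `Px`, residual `mx`;
* `reachHoldsRHNOFnL_negChoiceAllOTA_RF (c) (Px) (mx)` — at the ledger values `gv := KS.gT 0 (KS.gxA c)`, `fv := KS.fT 0 KS.fxA`.
[cite: KozmaNitzan2024, §4 Theorem 6 (pp. 25–31); §1 p. 2 (approach 1)] [cite: BenjaminiSchramm1996, Conj. 4]
-/

noncomputable section

open scoped Classical

namespace Summit.CriticalPhenomena.PercolationContinuityZ3.Theorems.Transplant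

namespace PlanarSkeletonNeg

/-- **THE (C) HYPOTHESIS OF THE NODE AT `Sv := SUA (exAF c) mx`** (slot ledger (ζ′) v2), for every face-kit index `c`, every width pair
`gx fx`, every extra-pair slot `Px` and every excess residual `mx`: the two `ex`-floors of the general wrapper hold at `exAF c` because they
hold at `exA` (`NegB.hex_exA`) and `exA ≤ exAF c` (`NegB.exAF_eq`). [cite: KozmaNitzan2024, §4 Theorem 6 (pp. 25–31)] -/
theorem reachHoldsRHNOFnL_negChoiceAllOTA_exAF (c : ℕ) (gx fx : Neg.FSlot) (Px : NegB.PSlot) (mx : NegB.GSlot) :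
    ReachHoldsRHNOFnL NegB.LfA
      (negChoiceAllOTA (NegB.KS.gT 0 gx) (NegB.KS.fT 0 fx) (NegB.KS.PR 0 Px) (NegB.SUA (NegB.exAF c) mx)) :=
  reachHoldsRHNOFnL_negChoiceAllOTA 0 gx fx Px (NegB.exAF c) mx fun κ _ _ _ _ _ Φ t p D => by
    obtain ⟨h1, h2⟩ := NegB.hex_exA gx fx κ Φ t p D
    have hle := (NegB.exAF_eq κ Φ t p D c (NegB.KS.gT 0 gx κ Φ t p D) (NegB.KS.fT 0 fx κ Φ t p D)).2
    exact ⟨h1.trans hle, h2.trans hle⟩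

/-- **THE (C) HYPOTHESIS OF THE NODE AT THE SLOT-LEDGER (ζ′) v2 VALUES** `gv := KS.gT 0 (KS.gxA c)`, `fv := KS.fT 0 KS.fxA`,
`Sv := SUA (exAF c) mx` (`Px`, `mx` binders). [cite: KozmaNitzan2024, §4 Theorem 6 (pp. 25–31)] -/
theorem reachHoldsRHNOFnL_negChoiceAllOTA_RF (c : ℕ) (Px : NegB.PSlot) (mx : NegB.GSlot) :
    ReachHoldsRHNOFnL NegB.LfA
      (negChoiceAllOTA (NegB.KS.gT 0 (NegB.KS.gxA c)) (NegB.KS.fT 0 NegB.KS.fxA) (NegB.KS.PR 0 Px) (NegB.SUA (NegB.exAF c) mx)) :=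
  reachHoldsRHNOFnL_negChoiceAllOTA_exAF c (NegB.KS.gxA c) NegB.KS.fxA Px mx

open SkelConc (Consts) in
open Skelφ.StepI (DataN) in
/-- **THE (C) HYPOTHESIS AT EVERY EXCESS SLOT DOMINATING `exA`** — the slot-robust form: for ALL width slots `gx fx`, every pair slot
`Px`, and every excess slot `ex` with `exA ≤ ex` POINTWISE IN `κ` (so in particular the v2 value `exAF c` for a constant `c`, a `κ`-dependent
bridge index `ex := fun κ … => exAF (cK κ) κ …`, or any later re-version that only ENLARGES `ex`), the (C) hypothesis of the node holds.  The
two `ex`-floors of the general wrapper are monotone in `ex`. [cite: KozmaNitzan2024, §4 Theorem 6 (pp. 25–31)] -/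
theorem reachHoldsRHNOFnL_negChoiceAllOTA_of_exA_le (gx fx : Neg.FSlot) (Px : NegB.PSlot) (ex mx : NegB.GSlot)
    (hle : ∀ (κ : Consts) {V : Type} [DecidableEq V] [Countable V] {G : SimpleGraph V} [G.LocallyFinite] (Φ : PlanarSkeletonNeg G) (t : V)
      (p : unitInterval) (D : DataN V),
      NegB.exA κ Φ t p D (NegB.KS.gT 0 gx κ Φ t p D) (NegB.KS.fT 0 fx κ Φ t p D) ≤ ex κ Φ t p D (NegB.KS.gT 0 gx κ Φ t p D) (NegB.KS.fT 0 fx κ Φ t p D)) :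
    ReachHoldsRHNOFnL NegB.LfA
      (negChoiceAllOTA (NegB.KS.gT 0 gx) (NegB.KS.fT 0 fx) (NegB.KS.PR 0 Px) (NegB.SUA ex mx)) :=
  reachHoldsRHNOFnL_negChoiceAllOTA 0 gx fx Px ex mx fun κ _ _ _ _ _ Φ t p D => by
    obtain ⟨h1, h2⟩ := NegB.hex_exA gx fx κ Φ t p D
    have h := hle κ Φ t p D
    exact ⟨h1.trans h, h2.trans h⟩

end PlanarSkeletonNeg

end Summit.CriticalPhenomena.PercolationContinuityZ3.Theorems.Transplant

end
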